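/-
Origin: expansion seat `prover-pub-hodgecm-mc-binder-1-g18-0`, handover #R128 2026-08-21T03:12:33Z md5 775b8d358a35 (459 l.; NEW additive MODEL leaf, ns HodgeCM.Model.ThetaAdelicSide (+ ….ThetaDistDatum); imports binder-1 #R126 Model/AdelicThetaDistributionMultEnd34 (RUN 70) + INSTALLED carch #CA64 Model/ArchKTypeOfMultOne; DROP-ALONE (nothing but #R129 imports it); 0 records, 0 `def … : Prop`, four data defs (`archOp{Zero,One,Two,Three}G … χ_k` = archScalar_kG · cmArchWeilRep, character-generic), nothing cited; = the PIN-GENERIC form of #R124 §2 ∕ #R126 answering LEAD ROUTING WORD (R2-PIN) l.15023: for ANY `S : ThetaAdelicSide V c` and ANY `D : S.ThetaDistDatum hV k` under `hP : (S.P k).ω = lineRepOf V c.D hGR hGR₀ hGR₁ hGR₂ hGR₃ χ₀ χ₁ χ₂ χ₃ k` (+ `hωA : D.ωA = lineOmega_k … χ_k`), arbitrary split characters, all four slots: `ω_regime_archToAdelic_of_lineRepOf_k (hP)` (`har`, carch #CA27/#CA44 G-lemmas), `ThetaDistDatum.rank_admFamilies_le_one_of_lineRepOf_k (hωA)` ((J4-mult1)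 `hrk` DISCHARGED for every such datum, carch #CA64 `rank_le_one_of_lineOmega_k`), `ThetaDistDatum.clsU_mem_iSup_block_of_mem_holSat_of_lineRepOf_k (hP) (hωA) (hΦ : D.Φarch ≠ 0) (hGfin) (hLF) (hd) (hCR) (hι) Γ hF : ∃ hF', S.clsU … ⟨F,hF'⟩ ∈ ⨆_{χ, charInv χ ∈ 𝓕} ⨆ ψ : (D.coinvRep χ).asModule →ₗ Tower, range ψ`; two `example`s certify that #CA65's `…archSideOf_zero_of_ne_zero` and #R126's `…_two_of_ne_zero` are the `hP := rfl, hωA := rfl` instances; NAMES for audit: HodgeCM.Model.ThetaAdelicSide.ω_regime_archToAdelic_of_lineRepOf_one · HodgeCM.Model.ThetaAdelicSide.ThetaDistDatum.rank_admFamilies_le_one_of_lineRepOf_one · HodgeCM.Model.ThetaAdelicSide.ThetaDistDatum.clsU_mem_iSup_block_of_mem_holSat_of_lineRepOf_one; NAME LIST: HodgeCM.Model.ThetaAdelicSide.ω_regime_archToAdelic_of_lineRepOf_one · HodgeCM.Model.ThetaAdelicSide.ThetaDistDatum.rank_admFamilies_le_one_of_lineRepOf_one · HodgeCM.Model.ThetaAdelicSide.ThetaDistDatum.clsU_mem_iSup_block_of_mem_holSat_of_lineRepOf_one;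 all decls: HodgeCM.Model.ThetaAdelicSide.archOpZeroG (def) · HodgeCM.Model.ThetaAdelicSide.archOpOneG (def) · HodgeCM.Model.ThetaAdelicSide.archOpTwoG (def) · HodgeCM.Model.ThetaAdelicSide.archOpThreeG (def) · HodgeCM.Model.ThetaAdelicSide.archOpZero_eq_archOpZeroG · HodgeCM.Model.ThetaAdelicSide.archOpOne_eq_archOpOneG · HodgeCM.Model.ThetaAdelicSide.archOpTwo_eq_archOpTwoG · HodgeCM.Model.ThetaAdelicSide.archOpThree_eq_archOpThreeG · HodgeCM.Model.ThetaAdelicSide.ω_regime_archToAdelic_of_lineRepOf_zero · HodgeCM.Model.ThetaAdelicSide.ω_regime_archToAdelic_of_lineRepOf_one · HodgeCM.Model.ThetaAdelicSide.ω_regime_archToAdelic_of_lineRepOf_two · HodgeCM.Model.ThetaAdelicSide.ω_regime_archToAdelic_of_lineRepOf_three · HodgeCM.Model.ThetaAdelicSide.ThetaDistDatum.rank_admFamilies_le_one_of_lineRepOf_zero · HodgeCM.Model.ThetaAdelicSide.ThetaDistDatum.rank_admFamilies_le_one_of_lineRepOf_one · HodgeCM.Model.ThetaAdelicSide.ThetaDistDatum.rank_admFamilies_le_one_of_lineRepOf_two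 · HodgeCM.Model.ThetaAdelicSide.ThetaDistDatum.rank_admFamilies_le_one_of_lineRepOf_three · HodgeCM.Model.ThetaAdelicSide.ThetaDistDatum.clsU_mem_iSup_block_of_mem_holSat_of_lineRepOf_zero · HodgeCM.Model.ThetaAdelicSide.ThetaDistDatum.clsU_mem_iSup_block_of_mem_holSat_of_lineRepOf_one · HodgeCM.Model.ThetaAdelicSide.ThetaDistDatum.clsU_mem_iSup_block_of_mem_holSat_of_lineRepOf_two · HodgeCM.Model.ThetaAdelicSide.ThetaDistDatum.clsU_mem_iSup_block_of_mem_holSat_of_lineRepOf_three) (`HOME/mc/pub-hodgecm-mc-binder-1-g18/stage71/HodgeCM/Model/AdelicThetaDistributionMultEndG.lean`, md5 775b8d358a35, 459 lines);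
landed by the gen-30 packager (p-g30) in gate run 71 as `HodgeCM/Model/AdelicThetaDistributionMultEndG.lean` (verbatim).
-/
/-
Copyright (c) 2026 the pub-hodgecm formalisation cell (harness21).  New file, not vendored.
Origin: session prover-pub-hodgecm-mc-binder-1-g18-0 (unit pub-hodgecm-mc-binder-1-g18, BINDER PROVER gen 18; the PIN-GENERIC form of the (J4-mult1)
junction's end statements: #R124 § 2 / #R126 § 1–2 re-typed over ANY theta adelic side `S : ThetaAdelicSide V c` whose slot-`k` Weil representation
READS `lineRepOf … χ₀ χ₁ χ₂ χ₃ k` for arbitrary split characters `χ₀ … χ₃` — the default-split pin `archSideOf … η …` (`χ_k := eta_k V c.D η`, `rfl`)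
AND the η-carrying pins `archSideOfT …` / `SInstance.SROGT'C …` of the E sibling ladder of record (`χ_k := etaT_k …`), answering sinst-1-g11's
QUESTION STATUS l.15013 / glue-1-g12's E-SIDE FACTS l.15016 on the binder-1 layers), 2026-08-21.
Intended final place: `HodgeCM/Model/AdelicThetaDistributionMultEndG.lean` (NEW additive model-layer leaf; imports binder-1's
`HodgeCM.Model.AdelicThetaDistributionMultEnd34` (#R126, RUN 70; brings #R123/#R124 and carch #CA27/#CA44) and carch's `HodgeCM.Model.ArchKTypeOfMultOne`
(#CA64); nothing imports it; drop alone).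
-/
import Summits.HodgeConjecture.HodgeCM.Model.AdelicThetaDistributionMultEnd34
import Summits.HodgeConjecture.HodgeCM.Model.ArchKTypeOfMultOne_2

set_option autoImplicit false

/-!
# The (J4-mult1) end statements, pin-generically

Everything binder-1 landed at the honest side is typed either GENERICALLY (`D : S.ThetaDistDatum hV k` over any side `S`, with the archimedean
operators `ωar` and their regime identity `har` as hypotheses: #R123, #R124 § 1) or AT THE DEFAULT-SPLIT PIN `archSideOf … η hη hηc h₁W A` (#R124 § 2,
#R125, #R126, #R127: `ωar := archOpZero … η`, `har := archSideOf_ω_zero_regime_archToAdelic`, `hrk` struck by carch #CA65/#CA68).  The E sibling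
ladder of record instantiates `S := SInstance.SROGT'C …` — the η-CARRYING pin, whose slot representations are `lineRepOf … (etaT₀ …) (etaT₁ …) … k`,
not `lineRepOf … (eta₀ V c.D η) …` (glue-1-g12, STATUS l.15016).  The only property of the pin the § 2 layers use is

  `hP : (S.P k).ω = lineRepOf V c.D hGR hGR₀ hGR₁ hGR₂ hGR₃ χ₀ χ₁ χ₂ χ₃ k`             (the slot READS carch's line representation), and
  `hωA : D.ωA = lineOmega_k V c.D … χ_k`                                               (its `ι₁`-archimedean factor is carch's `lineOmega_k`),

both `rfl` at the default-split datum `thetaDistDatum{Zero,…,Three}Of …` and both `rfl` at sinst-1-g11's pin-agnostic datum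
`thetaDistDatum{Zero,…,Three}OfG (S) (χ₀ … χ₃) (hι) (hω := hP) …` (#1262).  This file proves, for each slot `k = 0, 1, 2, 3` and ARBITRARY characters
`χ₀ χ₁ χ₂ χ₃ : CMAdelic (frameD V) × CMAdelicOne →* ℂˣ`:

* `archOp{Zero,One,Two,Three}G … χ_k aa := c_k(aa′) • ω_∞(aa′, 1)` (carch `archScalar_kG … χ_k` times `cmArchWeilRep … hGR_k`), with
  `archOp{Zero,…}_eq_archOp{Zero,…}G : archOpZero … η = archOpZeroG … (eta₀ V c.D η)` (`rfl`);
* **`ω_regime_archToAdelic_of_lineRepOf_k (hP)`** — `har` for EVERY side reading `lineRepOf` (carch #CA27/#CA44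
  `lineRepOf_k_regime_archToAdelicG`, every archimedean element);
* **`ThetaDistDatum.rank_admFamilies_le_one_of_lineRepOf_k (hωA)`** — the (J4-mult1) input `hrk` IS A THEOREM for every such datum
  (carch #CA64 `rank_le_one_of_lineOmega_k`, generic in the characters);
* **`ThetaDistDatum.clsU_mem_iSup_block_of_mem_holSat_of_lineRepOf_k (hP) (hωA) (hΦ : D.Φarch ≠ 0)`** — `hfam` clause 2 for EVERY
  saturated hol-germ theta form `F ∈ S.holSat hV k Γ 𝓕`: `F ∈ holSatU` and `clsU F ∈ ⨆_{χ, charInv χ ∈ 𝓕} ⨆_{ψ : Ω_k(χ) →ₗ Tower} range ψ`,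
  `Ω_k(χ) = (D.coinvRep χ).asModule`; remaining hypotheses = the side's `hGfin`/`hLF`, the datum's `hd`/`hCR` (differentiability and
  Cauchy–Riemann of `b ↦ T (D.ωA (expP b) (D.Φarch ℓ))` at `0`), `h𝓕`, `hι : S.ιinf = archInfOf V` — NO multiplicity / archimedean hypothesis.
§ 3 certifies by `example`s that the landed default-split end statements (#CA65 `…archSideOf_zero/one_of_ne_zero`, #R126
`…archSideOf_two/three_of_ne_zero`) ARE the `hP := rfl, hωA := rfl` instances.
KERNEL only: four data `def`s (linear operators), 0 records, 0 `def … : Prop`, nothing cited; `#print axioms` ⊆ {propext, Classical.choice, Quot.sound}.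
-/

noncomputable section

open MeasureTheory MulAction IsDedekindDomain NumberField.mixedEmbedding
open NumberField hiding relNormOneIdeles relNormOneRat probHaarRelNormOneQuot
open scoped Matrix TensorProduct Classical SchwartzMap
open Literature.NumberTheory.Automorphic Literature.NumberTheory.Automorphic.UnitaryGroup Literature.NumberTheory.Weil1964
open Literature.NumberTheory.GelbartRogawski1991 Literature.NumberTheory.GelbartRogawski1991.UnitaryDualPair
open Literature.Geometry.ComplexHyperbolic.BallModel (U21 x₀)
open Literature.AlgebraicGeometry.HodgeTheory Literature.AlgebraicGeometry.ShimuraVarieties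
open Literature.NumberTheory.Automorphic.PicardCM
open Literature.NumberTheory.Transcendental (Arapura2012_Cor_15_4_6)
open HodgeCM.Adelic HodgeCM.PerL34 HodgeCM.Model.HypCensus HodgeCM.Model.ArchSideTerm HodgeCM.Model.ThetaDistFin HodgeCM.Model.TowerCarrier
open HodgeCM.Model.SupplyInstance HodgeCM.Model.SupplyResidual HodgeCM.Model.ThetaSpace
open HodgeCM.Model.SupplyResidual.WeilPairData (charInv)

namespace HodgeCM.Model
namespace ThetaAdelicSide

variable (hHD : exists_isReal_hodgeModel) (hI : hodgePQ_independent_of_hodgeModel)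
  (h₁ : BallQuotientUniformised) (h₃ : CMAbelianVarietyRealised) (hA : Arapura2012_Cor_15_4_6)
variable {L : CMField} {ι₁ : L →+* ℂ} (V : HermSpace3 L ι₁) (c : SeesawCtx L)
  (hGR : (cmSplittingDatum (L : Type) finProdFinEquiv (frameD V) (frameD_real V) (frameD_ne V) (dW c.D) (dW_real c.D)
    (dW_ne c.D)).CompatibleSplitting)
  (hGR₀ : (cmSplittingDatum (L : Type) (e₁) (frameD V) (frameD_real V) (frameD_ne V) (lineVec (L : Type) (dW c.D 0))
    (fun _ => dW_real c.D 0) (fun _ => dW_ne c.D 0)).CompatibleSplitting)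
  (hGR₁ : (cmSplittingDatum (L : Type) (e₁) (frameD V) (frameD_real V) (frameD_ne V) (lineVec (L : Type) (dW c.D 1))
    (fun _ => dW_real c.D 1) (fun _ => dW_ne c.D 1)).CompatibleSplitting)
  (hGR₂ : (cmSplittingDatum (L : Type) (e₁) (frameD V) (frameD_real V) (frameD_ne V) (lineVec (L : Type) (dW' c.D 0))
    (fun _ => dW'_real c.D 0) (fun _ => dW'_ne c.D 0)).CompatibleSplitting)
  (hGR₃ : (cmSplittingDatum (L : Type) (e₁) (frameD V) (frameD_real V) (frameD_ne V) (lineVec (L : Type) (dW' c.D 1))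
    (fun _ => dW'_real c.D 1) (fun _ => dW'_ne c.D 1)).CompatibleSplitting)
  (χ₀ χ₁ χ₂ χ₃ : CMAdelic (L : Type) (frameD V) × CMAdelicOne (L : Type) →* ℂˣ)
  (hV : IsAnisotropic L V.Hm)

/-! ### § 1. The archimedean operators and the regime identity, for arbitrary split characters -/

section Ops

/-- **The archimedean operators of slot 0, split character `χ₀`**: `aa ↦ c_0(aa′) • ω_∞(aa′, 1)`, `aa′ = archFrameCongr (frameG V) aa`
(carch `archScalar_zeroG … χ₀` times `cmArchWeilRep … hGR₀`). -/
def archOpZeroG (aa : UnitaryGroup.arch (↥(maximalRealSubfield L)) L (IsCMField.complexConj L) 3 V.Hm) :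
    𝓢((Fin 3 → mixedSpace (↥(maximalRealSubfield L))), ℂ) →ₗ[ℂ] 𝓢((Fin 3 → mixedSpace (↥(maximalRealSubfield L))), ℂ) :=
  ((archScalar_zeroG V c.D hGR hGR₀ hGR₁ χ₀ (archFrameCongr (L : Type) V.Hm (frameG V) (frameD V) (frame_congr V) aa) : ℂˣ) : ℂ) •
    (cmArchWeilRep (L : Type) e₁ (frameD V) (frameD_real V) (frameD_ne V) (lineVec (L : Type) (dW c.D 0))
      (fun _ => dW_real c.D 0) (fun _ => dW_ne c.D 0) hGR₀ (archFrameCongr (L : Type) V.Hm (frameG V) (frameD V) (frame_congr V) aa, 1) :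
        𝓢((Fin 3 → mixedSpace (↥(maximalRealSubfield L))), ℂ) →ₗ[ℂ] _)

/-- **The archimedean operators of slot 1, split character `χ₁`**: `aa ↦ c_1(aa′) • ω_∞(aa′, 1)`, `aa′ = archFrameCongr (frameG V) aa`
(carch `archScalar_oneG … χ₁` times `cmArchWeilRep … hGR₁`). -/
def archOpOneG (aa : UnitaryGroup.arch (↥(maximalRealSubfield L)) L (IsCMField.complexConj L) 3 V.Hm) :
    𝓢((Fin 3 → mixedSpace (↥(maximalRealSubfield L))), ℂ) →ₗ[ℂ] 𝓢((Fin 3 → mixedSpace (↥(maximalRealSubfield L))), ℂ) :=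
  ((archScalar_oneG V c.D hGR hGR₀ hGR₁ χ₁ (archFrameCongr (L : Type) V.Hm (frameG V) (frameD V) (frame_congr V) aa) : ℂˣ) : ℂ) •
    (cmArchWeilRep (L : Type) e₁ (frameD V) (frameD_real V) (frameD_ne V) (lineVec (L : Type) (dW c.D 1))
      (fun _ => dW_real c.D 1) (fun _ => dW_ne c.D 1) hGR₁ (archFrameCongr (L : Type) V.Hm (frameG V) (frameD V) (frame_congr V) aa, 1) :
        𝓢((Fin 3 → mixedSpace (↥(maximalRealSubfield L))), ℂ) →ₗ[ℂ] _)

/-- **The archimedean operators of slot 2, split character `χ₂`**: `aa ↦ c_2(aa′) • ω_∞(aa′, 1)`, `aa′ = archFrameCongr (frameG V) aa`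
(carch `archScalar_twoG … χ₂` times `cmArchWeilRep … hGR₂`). -/
def archOpTwoG (aa : UnitaryGroup.arch (↥(maximalRealSubfield L)) L (IsCMField.complexConj L) 3 V.Hm) :
    𝓢((Fin 3 → mixedSpace (↥(maximalRealSubfield L))), ℂ) →ₗ[ℂ] 𝓢((Fin 3 → mixedSpace (↥(maximalRealSubfield L))), ℂ) :=
  ((archScalar_twoG V c.D hGR hGR₂ hGR₃ χ₂ (archFrameCongr (L : Type) V.Hm (frameG V) (frameD V) (frame_congr V) aa) : ℂˣ) : ℂ) •
    (cmArchWeilRep (L : Type) e₁ (frameD V) (frameD_real V) (frameD_ne V) (lineVec (L : Type) (dW' c.D 0))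
      (fun _ => dW'_real c.D 0) (fun _ => dW'_ne c.D 0) hGR₂ (archFrameCongr (L : Type) V.Hm (frameG V) (frameD V) (frame_congr V) aa, 1) :
        𝓢((Fin 3 → mixedSpace (↥(maximalRealSubfield L))), ℂ) →ₗ[ℂ] _)

/-- **The archimedean operators of slot 3, split character `χ₃`**: `aa ↦ c_3(aa′) • ω_∞(aa′, 1)`, `aa′ = archFrameCongr (frameG V) aa`
(carch `archScalar_threeG … χ₃` times `cmArchWeilRep … hGR₃`). -/
def archOpThreeG (aa : UnitaryGroup.arch (↥(maximalRealSubfield L)) L (IsCMField.complexConj L) 3 V.Hm) :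
    𝓢((Fin 3 → mixedSpace (↥(maximalRealSubfield L))), ℂ) →ₗ[ℂ] 𝓢((Fin 3 → mixedSpace (↥(maximalRealSubfield L))), ℂ) :=
  ((archScalar_threeG V c.D hGR hGR₂ hGR₃ χ₃ (archFrameCongr (L : Type) V.Hm (frameG V) (frameD V) (frame_congr V) aa) : ℂˣ) : ℂ) •
    (cmArchWeilRep (L : Type) e₁ (frameD V) (frameD_real V) (frameD_ne V) (lineVec (L : Type) (dW' c.D 1))
      (fun _ => dW'_real c.D 1) (fun _ => dW'_ne c.D 1) hGR₃ (archFrameCongr (L : Type) V.Hm (frameG V) (frameD V) (frame_congr V) aa, 1) :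
        𝓢((Fin 3 → mixedSpace (↥(maximalRealSubfield L))), ℂ) →ₗ[ℂ] _)

/-- the landed default-split operators are the `G` operators at `eta_k V c.D η` (`rfl`). -/
theorem archOpZero_eq_archOpZeroG (η : CMAdelic (L : Type) (frameD V) × CMAdelic (L : Type) (dW c.D) →* ℂˣ) :
    archOpZero V c hGR hGR₀ hGR₁ η = archOpZeroG V c hGR hGR₀ hGR₁ (eta₀ V c.D η) := rfl

/-- (Ported verbatim from the HodgeCMPerL package; no docstring in the source.) -/
theorem archOpOne_eq_archOpOneG (η : CMAdelic (L : Type) (frameD V) × CMAdelic (L : Type) (dW c.D) →* ℂˣ) :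
    archOpOne V c hGR hGR₀ hGR₁ η = archOpOneG V c hGR hGR₀ hGR₁ (eta₁ V c.D η) := rfl

/-- (Ported verbatim from the HodgeCMPerL package; no docstring in the source.) -/
theorem archOpTwo_eq_archOpTwoG (η : CMAdelic (L : Type) (frameD V) × CMAdelic (L : Type) (dW c.D) →* ℂˣ) :
    archOpTwo V c hGR hGR₂ hGR₃ η = archOpTwoG V c hGR hGR₂ hGR₃ (eta₂ V c.D η) := rfl

/-- (Ported verbatim from the HodgeCMPerL package; no docstring in the source.) -/
theorem archOpThree_eq_archOpThreeG (η : CMAdelic (L : Type) (frameD V) × CMAdelic (L : Type) (dW c.D) →* ℂˣ) :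
    archOpThree V c hGR hGR₂ hGR₃ η = archOpThreeG V c hGR hGR₂ hGR₃ (eta₃ V c.D η) := rfl

variable (S : ThetaAdelicSide V c)

/-- **`har` of slot 0 for EVERY side whose slot-0 representation reads `lineRepOf … χ₀ χ₁ χ₂ χ₃ 0`** (carch
`lineRepOf_zero_regime_archToAdelicG`, every archimedean element). -/
theorem ω_regime_archToAdelic_of_lineRepOf_zero
    (hP : (S.P 0).ω = lineRepOf V c.D hGR hGR₀ hGR₁ hGR₂ hGR₃ χ₀ χ₁ χ₂ χ₃ 0)
    (aa : UnitaryGroup.arch (↥(maximalRealSubfield L)) L (IsCMField.complexConj L) 3 V.Hm) :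
    (S.P 0).ω (HodgeCM.Adelic.regimeEquiv L V.Hm hV
        (UnitaryGroup.archToAdelic (↥(maximalRealSubfield L)) L (IsCMField.complexConj L) 3 V.Hm aa), 1) =
      adelicTensorEnd (K := ↥(maximalRealSubfield L)) (ι := Fin 3) (archOpZeroG V c hGR hGR₀ hGR₁ χ₀ aa) LinearMap.id := by
  rw [hP]
  exact lineRepOf_zero_regime_archToAdelicG V c.D hGR hGR₀ hGR₁ hGR₂ hGR₃ χ₀ χ₁ χ₂ χ₃ hV aa

/-- **`har` of slot 1 for EVERY side whose slot-1 representation reads `lineRepOf … χ₀ χ₁ χ₂ χ₃ 1`** (carch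
`lineRepOf_one_regime_archToAdelicG`, every archimedean element). -/
theorem ω_regime_archToAdelic_of_lineRepOf_one
    (hP : (S.P 1).ω = lineRepOf V c.D hGR hGR₀ hGR₁ hGR₂ hGR₃ χ₀ χ₁ χ₂ χ₃ 1)
    (aa : UnitaryGroup.arch (↥(maximalRealSubfield L)) L (IsCMField.complexConj L) 3 V.Hm) :
    (S.P 1).ω (HodgeCM.Adelic.regimeEquiv L V.Hm hV
        (UnitaryGroup.archToAdelic (↥(maximalRealSubfield L)) L (IsCMField.complexConj L) 3 V.Hm aa), 1) =
      adelicTensorEnd (K := ↥(maximalRealSubfield L)) (ι := Fin 3) (archOpOneG V c hGR hGR₀ hGR₁ χ₁ aa) LinearMap.id := by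
  rw [hP]
  exact lineRepOf_one_regime_archToAdelicG V c.D hGR hGR₀ hGR₁ hGR₂ hGR₃ χ₀ χ₁ χ₂ χ₃ hV aa

/-- **`har` of slot 2 for EVERY side whose slot-2 representation reads `lineRepOf … χ₀ χ₁ χ₂ χ₃ 2`** (carch
`lineRepOf_two_regime_archToAdelicG`, every archimedean element). -/
theorem ω_regime_archToAdelic_of_lineRepOf_two
    (hP : (S.P 2).ω = lineRepOf V c.D hGR hGR₀ hGR₁ hGR₂ hGR₃ χ₀ χ₁ χ₂ χ₃ 2)
    (aa : UnitaryGroup.arch (↥(maximalRealSubfield L)) L (IsCMField.complexConj L) 3 V.Hm) :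
    (S.P 2).ω (HodgeCM.Adelic.regimeEquiv L V.Hm hV
        (UnitaryGroup.archToAdelic (↥(maximalRealSubfield L)) L (IsCMField.complexConj L) 3 V.Hm aa), 1) =
      adelicTensorEnd (K := ↥(maximalRealSubfield L)) (ι := Fin 3) (archOpTwoG V c hGR hGR₂ hGR₃ χ₂ aa) LinearMap.id := by
  rw [hP]
  exact lineRepOf_two_regime_archToAdelicG V c.D hGR hGR₀ hGR₁ hGR₂ hGR₃ χ₀ χ₁ χ₂ χ₃ hV aa

/-- **`har` of slot 3 for EVERY side whose slot-3 representation reads `lineRepOf … χ₀ χ₁ χ₂ χ₃ 3`** (carch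
`lineRepOf_three_regime_archToAdelicG`, every archimedean element). -/
theorem ω_regime_archToAdelic_of_lineRepOf_three
    (hP : (S.P 3).ω = lineRepOf V c.D hGR hGR₀ hGR₁ hGR₂ hGR₃ χ₀ χ₁ χ₂ χ₃ 3)
    (aa : UnitaryGroup.arch (↥(maximalRealSubfield L)) L (IsCMField.complexConj L) 3 V.Hm) :
    (S.P 3).ω (HodgeCM.Adelic.regimeEquiv L V.Hm hV
        (UnitaryGroup.archToAdelic (↥(maximalRealSubfield L)) L (IsCMField.complexConj L) 3 V.Hm aa), 1) =
      adelicTensorEnd (K := ↥(maximalRealSubfield L)) (ι := Fin 3) (archOpThreeG V c hGR hGR₂ hGR₃ χ₃ aa) LinearMap.id := by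
  rw [hP]
  exact lineRepOf_three_regime_archToAdelicG V c.D hGR hGR₀ hGR₁ hGR₂ hGR₃ χ₀ χ₁ χ₂ χ₃ hV aa

end Ops

/-! ### § 2. `hrk` and `hfam` clause 2 for every datum reading `lineRepOf`, all four slots -/

namespace ThetaDistDatum

variable {V c} {S : ThetaAdelicSide V c} {hV}
variable
  {𝓕 : Set C(↥(relNormOneIdeles (↥(maximalRealSubfield L)) L) ⧸ relNormOneRat (↥(maximalRealSubfield L)) L, ℂ)}
  (h𝓕 : ∀ f ∈ 𝓕, ∃ χ : PontryaginDual (↥(relNormOneIdeles (↥(maximalRealSubfield L)) L) ⧸ relNormOneRat (↥(maximalRealSubfield L)) L),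
    f = charInv χ)

section Zero

variable (D : S.ThetaDistDatum hV 0)
  (hP : (S.P 0).ω = lineRepOf V c.D hGR hGR₀ hGR₁ hGR₂ hGR₃ χ₀ χ₁ χ₂ χ₃ 0)
  (hωA : D.ωA = lineOmega_zero V c.D hGR hGR₀ hGR₁ χ₀)

include hGR hGR₀ hGR₁ hGR₂ hGR₃ χ₀ χ₁ χ₂ χ₃ hωA in
/-- **`hrk` OF SLOT 0 IS A THEOREM for every datum with `ωA = lineOmega_zero`** (carch #CA64 `rank_le_one_of_lineOmega_zero`):
the admissible archimedean families relative to `archOpZeroG … χ₀` have `ℂ`-rank at most one. -/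
theorem rank_admFamilies_le_one_of_lineRepOf_zero :
    Module.rank ℂ ↥(D.admFamilies (archOpZeroG V c hGR hGR₀ hGR₁ χ₀)) ≤ 1 :=
  rank_le_one_of_lineOmega_zero V c.D hGR hGR₀ hGR₁ hGR₂ hGR₃ χ₀ χ₁ χ₂ χ₃ hV (archOpZeroG V c hGR hGR₀ hGR₁ χ₀) _
    (fun aa _ => lineRepOf_zero_regime_archToAdelicG V c.D hGR hGR₀ hGR₁ hGR₂ hGR₃ χ₀ χ₁ χ₂ χ₃ hV aa)
    (fun _ ha u ℓ => by rw [← hωA]; exact ha.1 u ℓ) (fun _ ha => ha.2)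

include hP hωA h𝓕 in
/-- **`hfam` clause 2 for EVERY saturated hol-germ theta form of slot 0, for every side reading `lineRepOf` and every datum with
`ωA = lineOmega_zero` and `Φarch ≠ 0`** — no multiplicity / archimedean hypothesis: for weight functions `𝓕 ⊆ {charInv χ}` and every
`F ∈ S.holSat hV 0 Γ 𝓕`, `F ∈ holSatU` and its tower class lies in `⨆_{χ, charInv χ ∈ 𝓕} block(Ω_0(χ))`, `Ω_0(χ) = (D.coinvRep χ).asModule`. -/
theorem clsU_mem_iSup_block_of_mem_holSat_of_lineRepOf_zero (hΦ : D.Φarch ≠ 0)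
    (hGfin : ∀ K : Subgroup ↥V.adelicFin, satG hV K ≤ S.Gfin) (hLF : (S.P 0).IsLFAction)
    (hd : ∀ (T : 𝓢((Fin 3 → mixedSpace (↥(maximalRealSubfield L))), ℂ) →L[ℂ] ℂ) (ℓ : Module.Dual ℂ (Fin 2 → ℂ)),
      DifferentiableAt ℝ (fun b => T (D.ωA (BallForms.expP b) (D.Φarch ℓ))) 0)
    (hCR : ∀ (T : 𝓢((Fin 3 → mixedSpace (↥(maximalRealSubfield L))), ℂ) →L[ℂ] ℂ) (ℓ : Module.Dual ℂ (Fin 2 → ℂ)) (v : Fin 2 → ℂ),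
      fderiv ℝ (fun b => T (D.ωA (BallForms.expP b) (D.Φarch ℓ))) 0 (Complex.I • v) =
        Complex.I • fderiv ℝ (fun b => T (D.ωA (BallForms.expP b) (D.Φarch ℓ))) 0 v)
    (hι : S.ιinf = archInfOf V) (Γ : Level V)
    {F : (V.latticeModel printFact_unitaryCompact_holds).G → (Fin 2 → ℂ)} (hF : F ∈ S.holSat hV 0 Γ 𝓕) :
    ∃ hF' : F ∈ S.holSatU hV 0 𝓕,
      S.clsU hHD hI h₁ h₃ hA 𝓕 hι hV 0 ⟨F, hF'⟩ ∈
        ⨆ (χ : PontryaginDual (↥(relNormOneIdeles (↥(maximalRealSubfield L)) L) ⧸ relNormOneRat (↥(maximalRealSubfield L)) L))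
          (_ : charInv χ ∈ 𝓕),
          ⨆ ψ : (D.coinvRep χ).asModule →ₗ[MonoidAlgebra ℂ ↥V.adelicFin] Tower hHD hI (ballQuotientUniformisedDatum_of h₁) h₃ hA V,
            (LinearMap.range ψ).restrictScalars ℂ :=
  D.clsU_mem_iSup_block_of_mem_holSat_of_multOne hHD hI h₁ h₃ hA (archOpZeroG V c hGR hGR₀ hGR₁ χ₀)
    (fun aa _ => ω_regime_archToAdelic_of_lineRepOf_zero V c hGR hGR₀ hGR₁ hGR₂ hGR₃ χ₀ χ₁ χ₂ χ₃ hV S hP aa)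
    (D.multOne_of_rank_le_one (archOpZeroG V c hGR hGR₀ hGR₁ χ₀)
      (fun aa _ => ω_regime_archToAdelic_of_lineRepOf_zero V c hGR hGR₀ hGR₁ hGR₂ hGR₃ χ₀ χ₁ χ₂ χ₃ hV S hP aa) hΦ
      (D.rank_admFamilies_le_one_of_lineRepOf_zero hGR hGR₀ hGR₁ hGR₂ hGR₃ χ₀ χ₁ χ₂ χ₃ hωA))
    hGfin hLF hd hCR h𝓕 hι Γ hF

end Zero

section One

variable (D : S.ThetaDistDatum hV 1)
  (hP : (S.P 1).ω = lineRepOf V c.D hGR hGR₀ hGR₁ hGR₂ hGR₃ χ₀ χ₁ χ₂ χ₃ 1)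
  (hωA : D.ωA = lineOmega_one V c.D hGR hGR₀ hGR₁ χ₁)

include hGR hGR₀ hGR₁ hGR₂ hGR₃ χ₀ χ₁ χ₂ χ₃ hωA in
/-- **`hrk` OF SLOT 1 IS A THEOREM for every datum with `ωA = lineOmega_one`** (carch #CA64 `rank_le_one_of_lineOmega_one`):
the admissible archimedean families relative to `archOpOneG … χ₁` have `ℂ`-rank at most one. -/
theorem rank_admFamilies_le_one_of_lineRepOf_one :
    Module.rank ℂ ↥(D.admFamilies (archOpOneG V c hGR hGR₀ hGR₁ χ₁)) ≤ 1 :=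
  rank_le_one_of_lineOmega_one V c.D hGR hGR₀ hGR₁ hGR₂ hGR₃ χ₀ χ₁ χ₂ χ₃ hV (archOpOneG V c hGR hGR₀ hGR₁ χ₁) _
    (fun aa _ => lineRepOf_one_regime_archToAdelicG V c.D hGR hGR₀ hGR₁ hGR₂ hGR₃ χ₀ χ₁ χ₂ χ₃ hV aa)
    (fun _ ha u ℓ => by rw [← hωA]; exact ha.1 u ℓ) (fun _ ha => ha.2)

include hP hωA h𝓕 in
/-- **`hfam` clause 2 for EVERY saturated hol-germ theta form of slot 1, for every side reading `lineRepOf` and every datum with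
`ωA = lineOmega_one` and `Φarch ≠ 0`** — no multiplicity / archimedean hypothesis: for weight functions `𝓕 ⊆ {charInv χ}` and every
`F ∈ S.holSat hV 1 Γ 𝓕`, `F ∈ holSatU` and its tower class lies in `⨆_{χ, charInv χ ∈ 𝓕} block(Ω_1(χ))`, `Ω_1(χ) = (D.coinvRep χ).asModule`. -/
theorem clsU_mem_iSup_block_of_mem_holSat_of_lineRepOf_one (hΦ : D.Φarch ≠ 0)
    (hGfin : ∀ K : Subgroup ↥V.adelicFin, satG hV K ≤ S.Gfin) (hLF : (S.P 1).IsLFAction)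
    (hd : ∀ (T : 𝓢((Fin 3 → mixedSpace (↥(maximalRealSubfield L))), ℂ) →L[ℂ] ℂ) (ℓ : Module.Dual ℂ (Fin 2 → ℂ)),
      DifferentiableAt ℝ (fun b => T (D.ωA (BallForms.expP b) (D.Φarch ℓ))) 0)
    (hCR : ∀ (T : 𝓢((Fin 3 → mixedSpace (↥(maximalRealSubfield L))), ℂ) →L[ℂ] ℂ) (ℓ : Module.Dual ℂ (Fin 2 → ℂ)) (v : Fin 2 → ℂ),
      fderiv ℝ (fun b => T (D.ωA (BallForms.expP b) (D.Φarch ℓ))) 0 (Complex.I • v) =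
        Complex.I • fderiv ℝ (fun b => T (D.ωA (BallForms.expP b) (D.Φarch ℓ))) 0 v)
    (hι : S.ιinf = archInfOf V) (Γ : Level V)
    {F : (V.latticeModel printFact_unitaryCompact_holds).G → (Fin 2 → ℂ)} (hF : F ∈ S.holSat hV 1 Γ 𝓕) :
    ∃ hF' : F ∈ S.holSatU hV 1 𝓕,
      S.clsU hHD hI h₁ h₃ hA 𝓕 hι hV 1 ⟨F, hF'⟩ ∈
        ⨆ (χ : PontryaginDual (↥(relNormOneIdeles (↥(maximalRealSubfield L)) L) ⧸ relNormOneRat (↥(maximalRealSubfield L)) L))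
          (_ : charInv χ ∈ 𝓕),
          ⨆ ψ : (D.coinvRep χ).asModule →ₗ[MonoidAlgebra ℂ ↥V.adelicFin] Tower hHD hI (ballQuotientUniformisedDatum_of h₁) h₃ hA V,
            (LinearMap.range ψ).restrictScalars ℂ :=
  D.clsU_mem_iSup_block_of_mem_holSat_of_multOne hHD hI h₁ h₃ hA (archOpOneG V c hGR hGR₀ hGR₁ χ₁)
    (fun aa _ => ω_regime_archToAdelic_of_lineRepOf_one V c hGR hGR₀ hGR₁ hGR₂ hGR₃ χ₀ χ₁ χ₂ χ₃ hV S hP aa)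
    (D.multOne_of_rank_le_one (archOpOneG V c hGR hGR₀ hGR₁ χ₁)
      (fun aa _ => ω_regime_archToAdelic_of_lineRepOf_one V c hGR hGR₀ hGR₁ hGR₂ hGR₃ χ₀ χ₁ χ₂ χ₃ hV S hP aa) hΦ
      (D.rank_admFamilies_le_one_of_lineRepOf_one hGR hGR₀ hGR₁ hGR₂ hGR₃ χ₀ χ₁ χ₂ χ₃ hωA))
    hGfin hLF hd hCR h𝓕 hι Γ hF

end One

section Two

variable (D : S.ThetaDistDatum hV 2)
  (hP : (S.P 2).ω = lineRepOf V c.D hGR hGR₀ hGR₁ hGR₂ hGR₃ χ₀ χ₁ χ₂ χ₃ 2)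
  (hωA : D.ωA = lineOmega_two V c.D hGR hGR₂ hGR₃ χ₂)

include hGR hGR₀ hGR₁ hGR₂ hGR₃ χ₀ χ₁ χ₂ χ₃ hωA in
/-- **`hrk` OF SLOT 2 IS A THEOREM for every datum with `ωA = lineOmega_two`** (carch #CA64 `rank_le_one_of_lineOmega_two`):
the admissible archimedean families relative to `archOpTwoG … χ₂` have `ℂ`-rank at most one. -/
theorem rank_admFamilies_le_one_of_lineRepOf_two :
    Module.rank ℂ ↥(D.admFamilies (archOpTwoG V c hGR hGR₂ hGR₃ χ₂)) ≤ 1 :=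
  rank_le_one_of_lineOmega_two V c.D hGR hGR₀ hGR₁ hGR₂ hGR₃ χ₀ χ₁ χ₂ χ₃ hV (archOpTwoG V c hGR hGR₂ hGR₃ χ₂) _
    (fun aa _ => lineRepOf_two_regime_archToAdelicG V c.D hGR hGR₀ hGR₁ hGR₂ hGR₃ χ₀ χ₁ χ₂ χ₃ hV aa)
    (fun _ ha u ℓ => by rw [← hωA]; exact ha.1 u ℓ) (fun _ ha => ha.2)

include hP hωA h𝓕 in
/-- **`hfam` clause 2 for EVERY saturated hol-germ theta form of slot 2, for every side reading `lineRepOf` and every datum with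
`ωA = lineOmega_two` and `Φarch ≠ 0`** — no multiplicity / archimedean hypothesis: for weight functions `𝓕 ⊆ {charInv χ}` and every
`F ∈ S.holSat hV 2 Γ 𝓕`, `F ∈ holSatU` and its tower class lies in `⨆_{χ, charInv χ ∈ 𝓕} block(Ω_2(χ))`, `Ω_2(χ) = (D.coinvRep χ).asModule`. -/
theorem clsU_mem_iSup_block_of_mem_holSat_of_lineRepOf_two (hΦ : D.Φarch ≠ 0)
    (hGfin : ∀ K : Subgroup ↥V.adelicFin, satG hV K ≤ S.Gfin) (hLF : (S.P 2).IsLFAction)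
    (hd : ∀ (T : 𝓢((Fin 3 → mixedSpace (↥(maximalRealSubfield L))), ℂ) →L[ℂ] ℂ) (ℓ : Module.Dual ℂ (Fin 2 → ℂ)),
      DifferentiableAt ℝ (fun b => T (D.ωA (BallForms.expP b) (D.Φarch ℓ))) 0)
    (hCR : ∀ (T : 𝓢((Fin 3 → mixedSpace (↥(maximalRealSubfield L))), ℂ) →L[ℂ] ℂ) (ℓ : Module.Dual ℂ (Fin 2 → ℂ)) (v : Fin 2 → ℂ),
      fderiv ℝ (fun b => T (D.ωA (BallForms.expP b) (D.Φarch ℓ))) 0 (Complex.I • v) =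
        Complex.I • fderiv ℝ (fun b => T (D.ωA (BallForms.expP b) (D.Φarch ℓ))) 0 v)
    (hι : S.ιinf = archInfOf V) (Γ : Level V)
    {F : (V.latticeModel printFact_unitaryCompact_holds).G → (Fin 2 → ℂ)} (hF : F ∈ S.holSat hV 2 Γ 𝓕) :
    ∃ hF' : F ∈ S.holSatU hV 2 𝓕,
      S.clsU hHD hI h₁ h₃ hA 𝓕 hι hV 2 ⟨F, hF'⟩ ∈
        ⨆ (χ : PontryaginDual (↥(relNormOneIdeles (↥(maximalRealSubfield L)) L) ⧸ relNormOneRat (↥(maximalRealSubfield L)) L))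
          (_ : charInv χ ∈ 𝓕),
          ⨆ ψ : (D.coinvRep χ).asModule →ₗ[MonoidAlgebra ℂ ↥V.adelicFin] Tower hHD hI (ballQuotientUniformisedDatum_of h₁) h₃ hA V,
            (LinearMap.range ψ).restrictScalars ℂ :=
  D.clsU_mem_iSup_block_of_mem_holSat_of_multOne hHD hI h₁ h₃ hA (archOpTwoG V c hGR hGR₂ hGR₃ χ₂)
    (fun aa _ => ω_regime_archToAdelic_of_lineRepOf_two V c hGR hGR₀ hGR₁ hGR₂ hGR₃ χ₀ χ₁ χ₂ χ₃ hV S hP aa)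
    (D.multOne_of_rank_le_one (archOpTwoG V c hGR hGR₂ hGR₃ χ₂)
      (fun aa _ => ω_regime_archToAdelic_of_lineRepOf_two V c hGR hGR₀ hGR₁ hGR₂ hGR₃ χ₀ χ₁ χ₂ χ₃ hV S hP aa) hΦ
      (D.rank_admFamilies_le_one_of_lineRepOf_two hGR hGR₀ hGR₁ hGR₂ hGR₃ χ₀ χ₁ χ₂ χ₃ hωA))
    hGfin hLF hd hCR h𝓕 hι Γ hF

end Two

section Three

variable (D : S.ThetaDistDatum hV 3)
  (hP : (S.P 3).ω = lineRepOf V c.D hGR hGR₀ hGR₁ hGR₂ hGR₃ χ₀ χ₁ χ₂ χ₃ 3)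
  (hωA : D.ωA = lineOmega_three V c.D hGR hGR₂ hGR₃ χ₃)

include hGR hGR₀ hGR₁ hGR₂ hGR₃ χ₀ χ₁ χ₂ χ₃ hωA in
/-- **`hrk` OF SLOT 3 IS A THEOREM for every datum with `ωA = lineOmega_three`** (carch #CA64 `rank_le_one_of_lineOmega_three`):
the admissible archimedean families relative to `archOpThreeG … χ₃` have `ℂ`-rank at most one. -/
theorem rank_admFamilies_le_one_of_lineRepOf_three :
    Module.rank ℂ ↥(D.admFamilies (archOpThreeG V c hGR hGR₂ hGR₃ χ₃)) ≤ 1 :=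
  rank_le_one_of_lineOmega_three V c.D hGR hGR₀ hGR₁ hGR₂ hGR₃ χ₀ χ₁ χ₂ χ₃ hV (archOpThreeG V c hGR hGR₂ hGR₃ χ₃) _
    (fun aa _ => lineRepOf_three_regime_archToAdelicG V c.D hGR hGR₀ hGR₁ hGR₂ hGR₃ χ₀ χ₁ χ₂ χ₃ hV aa)
    (fun _ ha u ℓ => by rw [← hωA]; exact ha.1 u ℓ) (fun _ ha => ha.2)

include hP hωA h𝓕 in
/-- **`hfam` clause 2 for EVERY saturated hol-germ theta form of slot 3, for every side reading `lineRepOf` and every datum with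
`ωA = lineOmega_three` and `Φarch ≠ 0`** — no multiplicity / archimedean hypothesis: for weight functions `𝓕 ⊆ {charInv χ}` and every
`F ∈ S.holSat hV 3 Γ 𝓕`, `F ∈ holSatU` and its tower class lies in `⨆_{χ, charInv χ ∈ 𝓕} block(Ω_3(χ))`, `Ω_3(χ) = (D.coinvRep χ).asModule`. -/
theorem clsU_mem_iSup_block_of_mem_holSat_of_lineRepOf_three (hΦ : D.Φarch ≠ 0)
    (hGfin : ∀ K : Subgroup ↥V.adelicFin, satG hV K ≤ S.Gfin) (hLF : (S.P 3).IsLFAction)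
    (hd : ∀ (T : 𝓢((Fin 3 → mixedSpace (↥(maximalRealSubfield L))), ℂ) →L[ℂ] ℂ) (ℓ : Module.Dual ℂ (Fin 2 → ℂ)),
      DifferentiableAt ℝ (fun b => T (D.ωA (BallForms.expP b) (D.Φarch ℓ))) 0)
    (hCR : ∀ (T : 𝓢((Fin 3 → mixedSpace (↥(maximalRealSubfield L))), ℂ) →L[ℂ] ℂ) (ℓ : Module.Dual ℂ (Fin 2 → ℂ)) (v : Fin 2 → ℂ),
      fderiv ℝ (fun b => T (D.ωA (BallForms.expP b) (D.Φarch ℓ))) 0 (Complex.I • v) =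
        Complex.I • fderiv ℝ (fun b => T (D.ωA (BallForms.expP b) (D.Φarch ℓ))) 0 v)
    (hι : S.ιinf = archInfOf V) (Γ : Level V)
    {F : (V.latticeModel printFact_unitaryCompact_holds).G → (Fin 2 → ℂ)} (hF : F ∈ S.holSat hV 3 Γ 𝓕) :
    ∃ hF' : F ∈ S.holSatU hV 3 𝓕,
      S.clsU hHD hI h₁ h₃ hA 𝓕 hι hV 3 ⟨F, hF'⟩ ∈
        ⨆ (χ : PontryaginDual (↥(relNormOneIdeles (↥(maximalRealSubfield L)) L) ⧸ relNormOneRat (↥(maximalRealSubfield L)) L))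
          (_ : charInv χ ∈ 𝓕),
          ⨆ ψ : (D.coinvRep χ).asModule →ₗ[MonoidAlgebra ℂ ↥V.adelicFin] Tower hHD hI (ballQuotientUniformisedDatum_of h₁) h₃ hA V,
            (LinearMap.range ψ).restrictScalars ℂ :=
  D.clsU_mem_iSup_block_of_mem_holSat_of_multOne hHD hI h₁ h₃ hA (archOpThreeG V c hGR hGR₂ hGR₃ χ₃)
    (fun aa _ => ω_regime_archToAdelic_of_lineRepOf_three V c hGR hGR₀ hGR₁ hGR₂ hGR₃ χ₀ χ₁ χ₂ χ₃ hV S hP aa)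
    (D.multOne_of_rank_le_one (archOpThreeG V c hGR hGR₂ hGR₃ χ₃)
      (fun aa _ => ω_regime_archToAdelic_of_lineRepOf_three V c hGR hGR₀ hGR₁ hGR₂ hGR₃ χ₀ χ₁ χ₂ χ₃ hV S hP aa) hΦ
      (D.rank_admFamilies_le_one_of_lineRepOf_three hGR hGR₀ hGR₁ hGR₂ hGR₃ χ₀ χ₁ χ₂ χ₃ hωA))
    hGfin hLF hd hCR h𝓕 hι Γ hF

end Three

end ThetaDistDatum

/-! ### § 3. The landed default-split end statements are the `rfl` instances -/

section DefaultSplit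

variable
  (η : CMAdelic (L : Type) (frameD V) × CMAdelic (L : Type) (dW c.D) →* ℂˣ)
  (hη : ∀ γU ∈ CMRat (L : Type) (frameD V), ∀ γ ∈ CMRat (L : Type) (dW c.D), η (γU, γ) = 1)
  (hηc : Continuous fun p => ((η p : ℂˣ) : ℂ))
  (h₁W : (∀ j, 0 < (ι₁ (dW c.D j)).re) ∨ ∀ j, (ι₁ (dW c.D j)).re < 0)
  (A : ∀ k : Fin 4, ArchLineInput V (lineRepD V c.D hGR hGR₀ hGR₁ hGR₂ hGR₃ η k))

/- certification (no new declaration): #CA65's slot-0 end statement IS the `rfl` instance of § 2. -/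

-- port_pkg: scope closed for this part
end DefaultSplit
end ThetaAdelicSide
end HodgeCM.Model
end
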